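import Summits.KontsevichZagierPeriods.KontsevichZagierPeriods.Theses.LiouvilleUnfolding
import Literature.NumberTheory.Transcendental.KZLogCalculusProofs
import Literature.NumberTheory.Transcendental.KZFibredRelations
import Literature.NumberTheory.Transcendental.KZProduct
import Literature.NumberTheory.Transcendental.KZProductIdeal
import Literature.NumberTheory.Transcendental.PeriodConjecture
import Literature.NumberTheory.Transcendental.KZRulesAssociator

/-! Scratch checks for crux-triage r1-3 of stmt-KontsevichZagierPeriods-2837 (LogKernelConjecture). -/

noncomputable section
open MeasureTheory Set
open Literature.NumberTheory.Transcendental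

namespace TriageR1K3

/-! ## Idea 1 (families-baker-semantic-log-rule): typed first lemma, as quoted on the card -/

def VanishingLogTerm : Prop :=
  ∀ (n : ℕ) (T : KZlog.IntegralRep n), (∀ x ∈ T.domain, T.integrand x = 0) →
    KZlog.of T ∈ KZlog.relations

def VanishingLogTermKZ : Prop :=
  ∀ (n : ℕ) (T : KZlog.IntegralRep n), (∀ x ∈ T.domain, T.integrand x = 0) →
    KZlog.unfold (KZlog.of T) ∈ KZ.relations

theorem vanishingLogTermKZ_iff : VanishingLogTerm ↔ VanishingLogTermKZ := by
  simp only [VanishingLogTerm, VanishingLogTermKZ, KZlog.relations_eq_comap_unfold,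
    AddSubgroup.mem_comap]

/-- Positive-sector sanity: the summit's kernel form implies the first lemma (so no cheap
refutation of it exists short of refuting Conjecture 1). -/
theorem vanishingLogTerm_of_kzKernelConjecture (h : KZKernelConjecture) : VanishingLogTerm := by
  rw [vanishingLogTermKZ_iff]
  intro n T hT
  apply h
  rw [KZlog.eval_unfold, KZlog.eval_of, KZlog.Term.value_eq]
  have : ∫ x in T.domain, T.integrand x = ∫ x in T.domain, (0 : ℝ) :=
    setIntegral_congr_fun T.measurableSet_domain (fun x hx => hT x hx)
  rw [this]
  simp

/-! ## Idea 3 (spectator-localisation): the split, re-checked here -/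

def DarkTorsion : Prop :=
  ∀ c : KZ.FormalRep, KZ.eval c = 0 → ∃ s : KZ.FormalRep, KZ.eval s ≠ 0 ∧ s * c ∈ KZ.relations

def SpectatorCancellation : Prop :=
  ∀ s c : KZ.FormalRep, KZ.eval s ≠ 0 → s * c ∈ KZ.relations → c ∈ KZ.relations

theorem kzKernelConjecture_iff_split : KZKernelConjecture ↔ DarkTorsion ∧ SpectatorCancellation := by
  constructor
  · intro h
    refine ⟨fun c hc => ⟨KZ.of KZ.IntegralRep.unit, ?_, KZ.of_mul_mem_relations _ (h c hc)⟩, ?_⟩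
    · simp [KZ.eval_of, KZ.IntegralRep.value_unit]
    · intro s c hs hsc
      apply h
      have h0 : KZ.eval (s * c) = 0 := KZ.relations_le_ker_eval_holds hsc
      rw [KZ.eval_mul' s c] at h0
      exact (mul_eq_zero.mp h0).resolve_left hs
  · rintro ⟨hD, hC⟩ c hc
    obtain ⟨s, hs, hsc⟩ := hD c hc
    exact hC s c hs hsc

/-- The split sandwiches the crux exactly as the summit does (costume check: the glue uses H1 only). -/
theorem logKernelConjecture_of_split (hD : DarkTorsion) (hC : SpectatorCancellation) :
    Summit.KontsevichZagierPeriods.KontsevichZagierPeriods.Theses.LiouvilleUnfolding.LogKernelConjecture := by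
  intro R hR _ c hc
  exact hR ((kzKernelConjecture_iff_split.2 ⟨hD, hC⟩) c hc)

/-- DarkTorsion is vacuous-free: the hypotheses are satisfiable (c = 0). SpectatorCancellation's
hypothesis `s * c ∈ relations` forces `eval c = 0` (so it only speaks about kernel elements). -/
theorem spectatorCancellation_hyp_forces_kernel {s c : KZ.FormalRep} (hs : KZ.eval s ≠ 0)
    (hsc : s * c ∈ KZ.relations) : KZ.eval c = 0 := by
  have h0 : KZ.eval (s * c) = 0 := KZ.relations_le_ker_eval_holds hsc
  rw [KZ.eval_mul' s c] at h0
  exact (mul_eq_zero.mp h0).resolve_left hs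

/-- First lemma of idea 3, typed as on the card. -/
def FibredSpectatorCancellation : Prop :=
  ∀ (s : KZ.IntegralRep 1) (c : KZ.FormalRep), s.value ≠ 0 →
    KZ.of s * c ∈ KZ.fibredRelations → c ∈ KZ.relations

/-- Positive-sector sanity: implied by the kernel conjecture. -/
theorem fibredSpectatorCancellation_of_kz (h : KZKernelConjecture) : FibredSpectatorCancellation := by
  intro s c hs hsc
  apply h
  have hsc' : KZ.of s * c ∈ KZ.relations := KZ.fibredRelations_le_relations hsc
  have := spectatorCancellation_hyp_forces_kernel (s := KZ.of s) (c := c) ?_ hsc'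
  · exact this
  · simpa [KZ.eval_of] using hs

/-! ## Idea 2 (rational-pushforward-normal-form): typed normal form, as quoted -/

def IsPureLogRep (d : ℕ) (s : KZ.IntegralRep (d + 1)) : Prop :=
  ∃ (τ : Set (Fin d → ℝ)) (h v : (Fin d → ℝ) → ℝ),
    s.domain = {z | (Fin.init z : Fin d → ℝ) ∈ τ ∧ 1 ≤ z (Fin.last d) ∧ z (Fin.last d) ≤ v (Fin.init z)} ∧
    EqOn s.integrand (fun z => h (Fin.init z) / z (Fin.last d)) s.domain

def IsPureArctanRep (d : ℕ) (s : KZ.IntegralRep (d + 1)) : Prop :=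
  ∃ (τ : Set (Fin d → ℝ)) (h v : (Fin d → ℝ) → ℝ),
    s.domain = {z | (Fin.init z : Fin d → ℝ) ∈ τ ∧ 0 ≤ z (Fin.last d) ∧ z (Fin.last d) ≤ v (Fin.init z)} ∧
    EqOn s.integrand (fun z => h (Fin.init z) / (1 + z (Fin.last d) ^ 2)) s.domain

def normalFormGens (d : ℕ) : Set KZ.FormalRep :=
  {x | ∃ s, IsPureLogRep d s ∧ x = KZ.of s} ∪ {x | ∃ s, IsPureArctanRep d s ∧ x = KZ.of s} ∪
    {x | ∃ s : KZ.IntegralRep d, x = KZ.of s}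

def PureLogNormalForm : Prop :=
  ∀ (d : ℕ) (r : KZ.IntegralRep (d + 1)), r.IsRational →
    ∃ c ∈ AddSubgroup.closure (normalFormGens d), KZ.of r - c ∈ KZ.relations

/-- probe: nothing cheap closes it -/
example : PureLogNormalForm := by
  sorry

end TriageR1K3
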